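import Mathlib
import HarnessLib
import Summits.HodgeConjecture.HodgeConjecture.Theses.EightfoldTwistedSheafSeeds
import Summits.HodgeConjecture.HodgeConjecture.Theorems.HeckePrymWeilSemiregularSpreadOfBlochLifts
import Summits.HodgeConjecture.HodgeConjecture.Theorems.EightfoldBlochSeedsBlochSpreadEightFourSupportAlongChart
import Summits.HodgeConjecture.HodgeConjecture.Theorems.EightfoldBlochSeedsBlochSpreadEightFourCodimOfRegularImmersion
import Literature.AlgebraicGeometry.HodgeTheory.BlochSemiregularSpread
import Literature.AlgebraicGeometry.HodgeTheory.BlochSemiregularityTheorem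
import Literature.AlgebraicGeometry.HodgeTheory.FlatFamilyCycleClass
import Literature.AlgebraicGeometry.HodgeTheory.BlochSemiregularCompIso
import Literature.AlgebraicGeometry.HodgeTheory.RegularImmersionIso
import Literature.AlgebraicGeometry.HodgeTheory.RegularImmersionConormal
import Literature.AlgebraicGeometry.HodgeTheory.ProperOverQuasiProjective
import Literature.AlgebraicGeometry.HodgeTheory.IsoTransport
import Literature.AlgebraicGeometry.HodgeTheory.ClassesSupportedOn

/-!
# Crux `BlochSpreadEightFour` (stmt-HodgeConjecture-18884), line `bloch-lifts-fulton`: the ZARISKI-LOCAL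
# relative-class input `(RC′)`

HONEST FRAMING: helper file (no stub is closed; nothing here proves `BlochSpreadEightFour`, rung H2, HC_AV
or HC). Sequel of `EightfoldBlochSeedsBlochSpreadEightFourOfRelativeClass.lean`: the relative class `Γ` of
the slice `(RC)` of Fulton's fact need only have algebraic fibre restrictions over a Zariski-OPEN
NEIGHBOURHOOD `U₁` of the marked point `v₀` (not over all of `V(ℂ)`):

  `(RC′)`: data of `(RC)` ⟹ `∃ Γ ∈ H²ᵖ(𝒳(ℂ); ℂ)` and a Zariski-open `U₁ ∋ v₀.pt` with `Γ|_{𝒳_t}`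
  algebraic for `t.pt ∈ U₁`, and `Γ|_{X₀}` a NON-ZERO class supported on the irreducible `W₀`.

This is the shape in which the proved steps (F3) (`…FultonSupportStep`), (F4) (`…FlatFamilyFibreCodim`)
and (F4′) (`…FlatFamilyComponents`) deliver conclusion (1) after shrinking `V` to an irreducible
separated neighbourhood of `v₀`. What is proved:

* `relativeClassNear_of_relativeClass` — `(RC) ⟹ (RC′)` (`U₁ = V`).
* `semiregularSpread_of_blochLifts_of_relativeClassNear` — the glue with input `(RC′)` (same proof as
  `semiregularSpread_of_blochLifts_of_relativeClass`; the rigidity open set is intersected with `U₁`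
  before descending along the open map `π`).
* `BlochSpreadEightFour_of_blochLifts_of_relativeClassNear` — the crux BY NAME from
  `Bloch1972_semiregularSubschemeLifts` and `(RC′)`.

References: [Bloch1972Semiregularity] Thm. (7.1), proof of Thm. (7.4), Remark (7.5); [BuchweitzFlenner2003]
§5; [Fulton1998] §10.1 Prop. 10.1 (a), §19.1 Lemma 19.1.1, §19.2 Cor. 19.2 (b); [VoisinHodgeII2003] §3.1.2.
-/

-- every declaration of this problem lives in `Summit.HodgeConjecture.HodgeConjecture.…` (summit = sub-problem)
set_option linter.dupNamespace false

noncomputable section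

open CategoryTheory CategoryTheory.Limits AlgebraicGeometry MonoidalCategory
open Literature.AlgebraicGeometry.Motives Literature.AlgebraicGeometry.HodgeTheory
open Literature.AlgebraicGeometry.Deformation
open Literature.AlgebraicTopology.SingularHomology

namespace Summit.HodgeConjecture.HodgeConjecture.Theorems

/-- `(RC)` implies its Zariski-local form `(RC′)` (take `U₁ = V`). [folklore] -/
theorem relativeClassNear_of_relativeClass
    (hR : ∀ ⦃n p : ℕ⦄ ⦃𝒳 V : SchemeOver ℂ⦄ (g : 𝒳 ⟶ V), 0 < p → IsSmoothProjectiveFamily g n →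
      AlgebraicGeometry.Smooth V.hom →
      ∀ (𝒲 : Scheme) (ι : 𝒲 ⟶ 𝒳.left), IsClosedImmersion ι → Flat (ι ≫ g.left) →
      ∀ (v₀ : ComplexPoints V) (W₀ : Set (fiberOver g v₀).left), IsClosed W₀ → IsIrreducible W₀ →
      Set.range (pullback.snd ι (fiberι g v₀).left).base = W₀ →
      (∀ z ∈ W₀, (p : ℕ∞) ≤ Order.coheight z) → (∃ z ∈ W₀, Order.coheight z = p) →
      ∃ Γ : complexBetti 𝒳 (2 * p),
        (∀ t : ComplexPoints V,
          complexBetti.map (fiberι g t) (2 * p) Γ ∈ algebraicClasses (fiberOver g t) p) ∧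
        complexBetti.map (fiberι g v₀) (2 * p) Γ ∈ classesSupportedOn (fiberOver g v₀) W₀ (2 * p) ∧
        complexBetti.map (fiberι g v₀) (2 * p) Γ ≠ 0) :
    ∀ ⦃n p : ℕ⦄ ⦃𝒳 V : SchemeOver ℂ⦄ (g : 𝒳 ⟶ V), 0 < p → IsSmoothProjectiveFamily g n →
      AlgebraicGeometry.Smooth V.hom →
      ∀ (𝒲 : Scheme) (ι : 𝒲 ⟶ 𝒳.left), IsClosedImmersion ι → Flat (ι ≫ g.left) →
      ∀ (v₀ : ComplexPoints V) (W₀ : Set (fiberOver g v₀).left), IsClosed W₀ → IsIrreducible W₀ →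
      Set.range (pullback.snd ι (fiberι g v₀).left).base = W₀ →
      (∀ z ∈ W₀, (p : ℕ∞) ≤ Order.coheight z) → (∃ z ∈ W₀, Order.coheight z = p) →
      ∃ (Γ : complexBetti 𝒳 (2 * p)) (U₁ : Set V.left), IsOpen U₁ ∧ v₀.pt ∈ U₁ ∧
        (∀ t : ComplexPoints V, t.pt ∈ U₁ →
          complexBetti.map (fiberι g t) (2 * p) Γ ∈ algebraicClasses (fiberOver g t) p) ∧
        complexBetti.map (fiberι g v₀) (2 * p) Γ ∈ classesSupportedOn (fiberOver g v₀) W₀ (2 * p) ∧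
        complexBetti.map (fiberι g v₀) (2 * p) Γ ≠ 0 := by
  intro n p 𝒳 V g hp hg hV 𝒲 ι hι hflat v₀ W₀ hW₀ hirr hrange hcodim hz
  obtain ⟨Γ, hΓ, hw, hw0⟩ := hR g hp hg hV 𝒲 ι hι hflat v₀ W₀ hW₀ hirr hrange hcodim hz
  exact ⟨Γ, Set.univ, isOpen_univ, Set.mem_univ _, fun t _ => hΓ t, hw, hw0⟩

/-- **Glue with the ZARISKI-LOCAL weakened Fulton input `(RC′)`** — as
`semiregularSpread_of_blochLifts_of_relativeClass`, but the relative class `Γ` need only have algebraic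
fibre restrictions over a Zariski-open neighbourhood `U₁` of the marked point (the rigidity open set is
intersected with `U₁` before descending along `π`). (the SPREAD step; Bloch 1972 Thm. (7.4)/(7.5) in the
input shape of the tree's object-level Bloch fact). Granted `Bloch1972_semiregularSubschemeLifts` and `(RC)`:
for a smooth projective family `f : 𝒳 ⟶ S` of relative dimension `n`, projective in Hartshorne's sense, over
a smooth `ℂ`-scheme `S`, a complex point `s₀`, an integral closed subscheme `i₀ : Z₀ ↪ X₀ = 𝒳_{s₀}` which is
a local complete intersection of codimension exactly `p` and Bloch-semiregular, and a global class
`W ∈ H²ᵖ(𝒳(ℂ); ℂ)` of fibrewise Hodge type `(p,p)` whose restriction to `X₀` is supported on `Z₀`, the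
restriction `W|_{𝒳_t}` is algebraic for every `t` in an open neighbourhood of `s₀` in `S(ℂ)`. Proof: that
of `HeckePrymWeilLine.semiregularSpread_of_blochLifts_of_fulton` verbatim, except that the relative class
`Γ` of Bloch's flat lift is taken from `(RC)` (its central restriction `w = Γ|_{X₀'}` is the non-zero
generator of the line of classes supported on the irreducible `W₀'`) and the rigid class is
`pr^* W - λ • Γ`. [cite: Bloch1972Semiregularity, Thm. (7.1), proof of Thm. (7.4) (pp. 64–65), Remark (7.5)]
[cite: BuchweitzFlenner2003, §5, end of the proof of Thm. 5.1 / Thm. 5.2]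
[cite: Fulton1998, §10.1 Cor. 10.1; §19.1 Lemma 19.1.1] [cite: VoisinHodgeII2003, §3.1.2] -/
theorem semiregularSpread_of_blochLifts_of_relativeClassNear
    (hB : Bloch1972_semiregularSubschemeLifts)
    (hR : ∀ ⦃n p : ℕ⦄ ⦃𝒳 V : SchemeOver ℂ⦄ (g : 𝒳 ⟶ V), 0 < p → IsSmoothProjectiveFamily g n →
      AlgebraicGeometry.Smooth V.hom →
      ∀ (𝒲 : Scheme) (ι : 𝒲 ⟶ 𝒳.left), IsClosedImmersion ι → Flat (ι ≫ g.left) →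
      ∀ (v₀ : ComplexPoints V) (W₀ : Set (fiberOver g v₀).left), IsClosed W₀ → IsIrreducible W₀ →
      Set.range (pullback.snd ι (fiberι g v₀).left).base = W₀ →
      (∀ z ∈ W₀, (p : ℕ∞) ≤ Order.coheight z) → (∃ z ∈ W₀, Order.coheight z = p) →
      ∃ (Γ : complexBetti 𝒳 (2 * p)) (U₁ : Set V.left), IsOpen U₁ ∧ v₀.pt ∈ U₁ ∧
        (∀ t : ComplexPoints V, t.pt ∈ U₁ →
          complexBetti.map (fiberι g t) (2 * p) Γ ∈ algebraicClasses (fiberOver g t) p) ∧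
        complexBetti.map (fiberι g v₀) (2 * p) Γ ∈ classesSupportedOn (fiberOver g v₀) W₀ (2 * p) ∧
        complexBetti.map (fiberι g v₀) (2 * p) Γ ≠ 0)
    {𝒳 S : SchemeOver ℂ} (f : 𝒳 ⟶ S) (n p : ℕ) (hf : IsSmoothProjectiveFamily f n)
    (hproj : ∃ (N : ℕ) (ε : 𝒳 ⟶ projectiveSpace N ℂ ⊗ S), IsClosedImmersion ε.left ∧
      ε ≫ CartesianMonoidalCategory.snd (projectiveSpace N ℂ) S = f)
    (hS : AlgebraicGeometry.Smooth S.hom)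
    (s₀ : ComplexPoints S) (Z₀ : Scheme) (i₀ : Z₀ ⟶ (fiberOver f s₀).left)
    (hi₀ : IsClosedImmersion i₀) (hlci : IsFiniteLocallyFree (conormalSheaf i₀))
    (hint : AlgebraicGeometry.IsIntegral Z₀)
    (hcoh : ∀ z : Z₀, (p : ℕ∞) ≤ Order.coheight (i₀.base z))
    (hcohp : ∃ z : Z₀, Order.coheight (i₀.base z) = (p : ℕ∞))
    (hsr : IsBlochSemiregular i₀ n p)
    (W : complexBetti 𝒳 (2 * p))
    (hW : ∀ s : ComplexPoints S,
      IsOfHodgeType n (fiberOver f s) (2 * p) p p (complexBetti.map (fiberι f s) (2 * p) W))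
    (hsupp : complexBetti.map (fiberι f s₀) (2 * p) W ∈
      classesSupportedOn (fiberOver f s₀) (Set.range i₀.base) (2 * p)) :
    ∃ U : Set (ComplexPoints S), IsOpen U ∧ s₀ ∈ U ∧
      ∀ t ∈ U, complexBetti.map (fiberι f t) (2 * p) W ∈ algebraicClasses (fiberOver f t) p := by
  haveI := hS
  haveI := hi₀
  haveI := hint
  -- codimension `0`: every class is algebraic
  rcases Nat.eq_zero_or_pos p with rfl | hp
  · exact ⟨Set.univ, isOpen_univ, Set.mem_univ _, fun t _ => by
      rw [algebraicClasses_zero]; trivial⟩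
  -- `W|_{X₀} = 0`: rigidity of the flat section near `s₀`
  by_cases h0 : complexBetti.map (fiberι f s₀) (2 * p) W = 0
  · obtain ⟨U, hU, hs₀U, hrig⟩ := exists_isOpen_forall_map_fiberι_eq_zero f hf s₀
    refine ⟨{t | t.pt ∈ U}, AlgPoints.isOpen_setOf_pt_mem (X := S) (L := ℂ) ⟨U, hU⟩, hs₀U,
      fun t ht => ?_⟩
    rw [hrig (2 * p) W h0 t ht]
    exact Submodule.zero_mem _
  -- the generic point `η` of the integral `Z₀` has codimension exactly `p` in `X₀` …
  haveI : IrreducibleSpace Z₀ := inferInstance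
  set η : Z₀ := genericPoint Z₀ with hηdef
  have hη : Order.coheight (i₀.base η) = (p : ℕ∞) := by
    obtain ⟨z₁, hz₁⟩ := hcohp
    refine le_antisymm ?_ (hcoh η)
    rw [← hz₁]
    exact Order.coheight_anti (Scheme.le_iff_specializes.2
      ((genericPoint_specializes z₁).map i₀.continuous))
  -- … and every point of codimension `p` of `Z₀` has closure `⊇ Z₀` in `X₀` (it is `η`)
  have hgen : ∀ z : Z₀, Order.coheight (i₀.base z) = (p : ℕ∞) →
      Set.range i₀.base ⊆ closure {i₀.base z} := by
    intro z hz
    have hle : i₀.base z ≤ i₀.base η :=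
      Scheme.le_iff_specializes.2 ((genericPoint_specializes z).map i₀.continuous)
    have hsp : i₀.base z ⤳ i₀.base η := by
      by_contra hne
      have hlt : i₀.base z < i₀.base η := lt_of_le_not_ge hle (fun h => hne (Scheme.le_iff_specializes.1 h))
      have := Order.coheight_strictAnti hlt (by rw [hη]; exact ENat.coe_lt_top p)
      rw [hη, hz] at this
      exact lt_irrefl _ this
    have hcl : closure {i₀.base η} = Set.range i₀.base := by
      rw [← Set.image_singleton, i₀.isClosedEmbedding.closure_image_eq, hηdef,
        genericPoint_closure, Set.image_univ]
    rw [← hcl]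
    exact specializes_iff_closure_subset.1 hsp
  -- Bloch: the semiregular lci `Z₀` lifts to a flat family over a smooth `π : V ⟶ S` through `s₀`
  have hpure : ∀ z : Z₀, ∃ z' : Z₀, Order.coheight (i₀.base z') = (p : ℕ∞) ∧ i₀.base z' ⤳ i₀.base z :=
    fun z => ⟨η, hη, (genericPoint_specializes z).map i₀.continuous⟩
  have hclass : ∀ z : Z₀, Order.coheight (i₀.base z) = (p : ℕ∞) →
      SupportClassStaysHodge f n p s₀ (closure {i₀.base z}) :=
    fun z hz => (SupportClassStaysHodge.intro W hW hsupp h0).mono (hgen z hz)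
  obtain ⟨V, π, hπ, v₀, hv₀, 𝒵, ι, hι, hflat, e, he⟩ :=
    hB.of_smooth f n p hf hproj hS s₀ Z₀ i₀ hi₀ hlci hpure hclass hsr
  subst hv₀
  haveI := hπ
  haveI := hι
  haveI : AlgebraicGeometry.Smooth V.hom := by rw [← Over.w π]; infer_instance
  have hg : IsSmoothProjectiveFamily (familyPullback.snd f π) n := hf.familyPullback_snd π
  -- `θ : X₀' ≅ X₀`, the fibre of the base change over `v₀` and the fibre of `f` over `π v₀`
  set θ := fiberOverFamilyPullbackIso f π v₀ with hθdef
  have hhi : ∀ y, θ.hom.left.base (θ.inv.left.base y) = y := fun y => by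
    rw [← Scheme.Hom.comp_apply, ← Over.comp_left, θ.inv_hom_id]; rfl
  have hih : ∀ x, θ.inv.left.base (θ.hom.left.base x) = x := fun x => by
    rw [← Scheme.Hom.comp_apply, ← Over.comp_left, θ.hom_inv_id]; rfl
  -- the transported set `W₀' = θ⁻¹(Z₀)` on `X₀'`
  set W₀' : Set (fiberOver (familyPullback.snd f π) v₀).left := θ.hom.left.base ⁻¹' Set.range i₀.base
    with hW₀'
  have hW₀'c : IsClosed W₀' := i₀.isClosedEmbedding.isClosed_range.preimage θ.hom.left.continuous
  have hW₀'i : IsIrreducible W₀' := by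
    have : W₀' = (fun w => θ.inv.left.base (i₀.base w)) '' Set.univ := by
      ext x
      simp only [hW₀', Set.mem_preimage, Set.mem_range, Set.image_univ]
      constructor
      · rintro ⟨w, hw⟩
        exact ⟨w, by rw [hw, hih]⟩
      · rintro ⟨w, rfl⟩
        exact ⟨w, (hhi _).symm⟩
    rw [this]
    exact (IrreducibleSpace.isIrreducible_univ _).image _ (by fun_prop : Continuous _).continuousOn
  -- the central fibre of the flat family is `W₀'` (`∪ ∅`)
  have hsnd : pullback.snd ι (fiberι (familyPullback.snd f π) v₀).left ≫ θ.hom.left = e.hom ≫ i₀ := by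
    haveI : Subsingleton ↥((specOver ℂ ℂ).left) := inferInstanceAs (Subsingleton (PrimeSpectrum ℂ))
    haveI : IsClosedImmersion (AlgPoints.map π v₀).left :=
      isClosedImmersion_of_comp_eq_id _ _ (ComplexPoints.toSpecHom_comp_hom (AlgPoints.map π v₀))
    haveI : Mono (fiberι f (AlgPoints.map π v₀)).left := by
      change Mono (pullback.fst f.left (AlgPoints.map π v₀).left); infer_instance
    rw [← cancel_mono (fiberι f (AlgPoints.map π v₀)).left, Category.assoc, Category.assoc,
      ← Over.comp_left, hθdef, fiberOverFamilyPullbackIso_hom_fiberι, Over.comp_left,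
      ← Category.assoc, ← pullback.condition, Category.assoc]
    exact he
  have hrange : Set.range (pullback.snd ι (fiberι (familyPullback.snd f π) v₀).left).base = W₀' ∪ ∅ := by
    have key : ∀ z, θ.hom.left.base ((pullback.snd ι (fiberι (familyPullback.snd f π) v₀).left).base z) =
        i₀.base (e.hom.base z) := fun z => by
      rw [← Scheme.Hom.comp_apply, hsnd, Scheme.Hom.comp_apply]
    rw [Set.union_empty]
    ext x
    constructor
    · rintro ⟨z, rfl⟩
      exact ⟨e.hom.base z, (key z).symm⟩
    · rintro ⟨z₀, hz₀⟩
      obtain ⟨z, rfl⟩ := e.hom.surjective z₀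
      exact ⟨z, by rw [← hih ((pullback.snd ι (fiberι (familyPullback.snd f π) v₀).left).base z),
          key, hz₀, hih]⟩
  have hcoh' : ∀ z ∈ W₀', (p : ℕ∞) ≤ Order.coheight z := by
    intro z hz
    obtain ⟨w, hw⟩ := hz
    rw [← coheight_left_base_eq_of_iso θ z, ← hw]
    exact hcoh w
  have hcoh2' : ∃ z ∈ W₀', Order.coheight z = (p : ℕ∞) :=
    ⟨θ.inv.left.base (i₀.base η), ⟨η, (hhi _).symm⟩, by
      rw [← hη, ← coheight_left_base_eq_of_iso θ, hhi]⟩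
  -- the relative class of the flat family (hypothesis `hR`)
  rw [Set.union_empty] at hrange
  obtain ⟨Γ, U₁, hU₁, hv₀U₁, hΓ, hw, hw0⟩ := hR (p := p) (familyPullback.snd f π) hp hg ‹_› 𝒵 ι hι
    hflat v₀ W₀' hW₀'c hW₀'i hrange hcoh' hcoh2'
  set w := complexBetti.map (fiberι (familyPullback.snd f π) v₀) (2 * p) Γ with hwdef
  -- purity: the classes supported on `W₀'` form a line, so `θ^* (W|_{X₀}) = λ • w`, `λ ≠ 0`
  obtain ⟨τ, hτ⟩ := exists_ker_restrictCompl_le_span_of_isIrreducible (hg.isSmoothProjective v₀)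
    hW₀'c hW₀'i (c := p) hp hcoh'
  set x₀ := complexBetti.map (fiberι f (AlgPoints.map π v₀)) (2 * p) W with hx₀def
  have hx₀' : complexBetti.map θ.hom (2 * p) x₀ ∈ classesSupportedOn _ W₀' (2 * p) :=
    mem_classesSupportedOn_iff.2
      (complexBetti.restrictCompl_map_eq_zero θ.hom (mem_classesSupportedOn_iff.1 hsupp))
  obtain ⟨lam, hlam⟩ : ∃ lam : ℂ, complexBetti.map θ.hom (2 * p) x₀ = lam • w := by
    obtain ⟨a, ha⟩ := Submodule.mem_span_singleton.1 (hτ hw)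
    obtain ⟨b, hb⟩ := Submodule.mem_span_singleton.1 (hτ hx₀')
    have ha0 : a ≠ 0 := by
      rintro rfl
      exact hw0 (by rw [← ha, zero_smul])
    exact ⟨b / a, by rw [← hb, ← ha, smul_smul, div_mul_cancel₀ b ha0]⟩
  have hlam0 : lam ≠ 0 := by
    rintro rfl
    rw [zero_smul] at hlam
    exact h0 ((complexBetti.bijective_map_of_iso θ (2 * p)).1 (by rw [hlam, map_zero]))
  -- the global class `Θ := pr^* W - λ • Γ` on `𝒳 ×_S V` vanishes on `X₀'`
  set Θ : complexBetti (familyPullback f π) (2 * p) :=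
    complexBetti.map (familyPullback.fst f π) (2 * p) W - lam • Γ with hΘ
  have hΘ0 : complexBetti.map (fiberι (familyPullback.snd f π) v₀) (2 * p) Θ = 0 := by
    rw [hΘ, map_sub, map_smul, map_fiberι_familyPullback, ← hθdef, ← hx₀def, hlam, ← hwdef, sub_self]
  -- rigidity over a Zariski neighbourhood `U` of `v₀`: there `pr^* W|_{X_{t'}} = (λ/c₀) • Γ|_{X_{t'}}`
  obtain ⟨U, hU, hv₀U, hrig⟩ := exists_isOpen_forall_map_fiberι_eq_zero (familyPullback.snd f π) hg v₀
  have halg : ∀ t' : ComplexPoints V, t'.pt ∈ U ∩ U₁ →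
      complexBetti.map (fiberι f (AlgPoints.map π t')) (2 * p) W ∈
        algebraicClasses (fiberOver f (AlgPoints.map π t')) p := by
    intro t' ht'
    rw [← map_fiberι_familyPullback_mem_algebraicClasses_iff f π hf W t']
    have hM := hrig (2 * p) Θ hΘ0 t' ht'.1
    rw [hΘ, map_sub, map_smul, sub_eq_zero] at hM
    rw [hM]
    exact Submodule.smul_mem _ _ (hΓ t' ht'.2)
  -- the image `π(U)` is a Zariski neighbourhood of `pt s₀`, and complex points over it lift to `U`
  haveI : LocallyOfFiniteType S.hom := inferInstance
  haveI : LocallyOfFiniteType π.left := inferInstance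
  have hπU : IsOpen ((π.left : V.left → S.left) '' (U ∩ U₁)) := π.left.isOpenMap _ (hU.inter hU₁)
  refine ⟨{t | t.pt ∈ (π.left : V.left → S.left) '' (U ∩ U₁)},
    AlgPoints.isOpen_setOf_pt_mem (X := S) (L := ℂ) ⟨_, hπU⟩, ⟨v₀.pt, ⟨hv₀U, hv₀U₁⟩, rfl⟩,
    fun t ht => ?_⟩
  obtain ⟨t', ht'U, rfl⟩ := exists_complexPoints_map_eq_of_pt_mem_image π (hU.inter hU₁) t ht
  exact halg t' ht'U


/-- **The crux from Bloch's lifting fact and the Zariski-local `(RC′)`** — the line's composition `BlochSpreadEightFour_of`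
with the Fulton stub weakened to `(RC)`: transport the seed along the chart `e : X₀ ≅ 𝒳_{s₀}`
(`IsRegularImmersionOfCodim.comp_iso`, `IsBlochSemiregular.comp_iso`, `coheight_left_base_eq_of_iso`), read
the codimension-`4` generic point (landed `stub_codimOfRegularImmersion`) and the support (landed
`stub_supportAlongChart`) in the fibre, Hartshorne projectivity of `f`, then
`semiregularSpread_of_blochLifts_of_relativeClass`. Conditional on the two displayed hypotheses; the
crux item is NOT closed by this theorem. [cite: Bloch1972Semiregularity, Thm. (7.4) and Remark (7.5)]
[cite: Fulton1998, §19.2 Cor. 19.2 (b)] -/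
theorem BlochSpreadEightFour_of_blochLifts_of_relativeClassNear (hB : Bloch1972_semiregularSubschemeLifts)
    (hR : ∀ ⦃n p : ℕ⦄ ⦃𝒳 V : SchemeOver ℂ⦄ (g : 𝒳 ⟶ V), 0 < p → IsSmoothProjectiveFamily g n →
      AlgebraicGeometry.Smooth V.hom →
      ∀ (𝒲 : Scheme) (ι : 𝒲 ⟶ 𝒳.left), IsClosedImmersion ι → Flat (ι ≫ g.left) →
      ∀ (v₀ : ComplexPoints V) (W₀ : Set (fiberOver g v₀).left), IsClosed W₀ → IsIrreducible W₀ →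
      Set.range (pullback.snd ι (fiberι g v₀).left).base = W₀ →
      (∀ z ∈ W₀, (p : ℕ∞) ≤ Order.coheight z) → (∃ z ∈ W₀, Order.coheight z = p) →
      ∃ (Γ : complexBetti 𝒳 (2 * p)) (U₁ : Set V.left), IsOpen U₁ ∧ v₀.pt ∈ U₁ ∧
        (∀ t : ComplexPoints V, t.pt ∈ U₁ →
          complexBetti.map (fiberι g t) (2 * p) Γ ∈ algebraicClasses (fiberOver g t) p) ∧
        complexBetti.map (fiberι g v₀) (2 * p) Γ ∈ classesSupportedOn (fiberOver g v₀) W₀ (2 * p) ∧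
        complexBetti.map (fiberι g v₀) (2 * p) Γ ≠ 0) :
    Summit.HodgeConjecture.HodgeConjecture.Theses.EightfoldTwistedSheafSeeds.BlochSpreadEightFour := by
  intro X₀ Z i x 𝒳 S f s₀ e W hi hreg hZ hcodim hsr hsupp hf h𝒳 hS hSm hW hx
  -- the central fibre is smooth projective, hence locally Noetherian; `Z` is integral
  haveI : IsLocallyNoetherian (fiberOver f s₀).left :=
    IsSmoothProjective.isLocallyNoetherian_holds (hf.isSmoothProjective s₀)
  haveI := hZ
  -- transport the seed along the chart `e : X₀ ≅ 𝒳_{s₀}`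
  have hreg' : IsRegularImmersionOfCodim (i ≫ e.hom.left) 4 := hreg.comp_iso (leftIso e)
  haveI : IsClosedImmersion (i ≫ e.hom.left) := hreg'.isClosedImmersion
  have hlci : IsFiniteLocallyFree (conormalSheaf (i ≫ e.hom.left)) :=
    hreg'.isFiniteLocallyFree_conormalSheaf
  have hsr' : IsBlochSemiregular (i ≫ e.hom.left) (2 * 4) 4 := IsBlochSemiregular.comp_iso e i hsr
  have hcoh : ∀ z : Z, ((4 : ℕ) : ℕ∞) ≤ Order.coheight ((i ≫ e.hom.left).base z) := by
    intro z
    have h1 : (i ≫ e.hom.left).base z = e.hom.left.base (i.base z) := rfl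
    rw [h1, coheight_left_base_eq_of_iso e (i.base z)]
    exact hcodim _ ⟨z, rfl⟩
  have hcohp : ∃ z : Z, Order.coheight ((i ≫ e.hom.left).base z) = ((4 : ℕ) : ℕ∞) :=
    stub_codimOfRegularImmersion (i ≫ e.hom.left) 4 hreg'
  -- Hartshorne projectivity of `f`
  have hproj := IsQuasiProjectiveOver.exists_isClosedImmersion_projectiveSpace_tensor_of_isSmoothProjectiveFamily
    f hf h𝒳
  -- the support of `W|_{X₀}` read in the fibre
  have hsupp' : complexBetti.map (fiberι f s₀) (2 * 4) W ∈
      classesSupportedOn (fiberOver f s₀) (Set.range (i ≫ e.hom.left).base) (2 * 4) :=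
    stub_supportAlongChart e i (2 * 4) _ (hx ▸ hsupp)
  exact semiregularSpread_of_blochLifts_of_relativeClassNear hB hR f (2 * 4) 4 hf hproj hSm s₀ Z
    (i ≫ e.hom.left) inferInstance hlci hZ hcoh hcohp hsr' W (fun s => (hW s).2) hsupp'

end Summit.HodgeConjecture.HodgeConjecture.Theorems

end
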